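import Mathlib
import Summits.Ventures.HodgeRepro2.LevelPositivity
import Summits.Ventures.HodgeRepro2.LevelBaseChange
import Summits.Ventures.HodgeRepro2.LevelInvariantsCount
import Summits.Ventures.HodgeRepro2.LiuOscillator
import Summits.Ventures.HodgeRepro2.T6B3Hyp
import Summits.Ventures.HodgeRepro2.T6B5Datum
import Summits.Ventures.HodgeRepro2.T6B5Hyp
import Summits.Ventures.HodgeRepro2.T6B5DirectSum
import Summits.Ventures.HodgeRepro2.T6B5Main
import Summits.Ventures.HodgeRepro2.T6B5OrbitHyp
import Summits.Ventures.HodgeRepro2.T6B5Orbit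
import Summits.Ventures.HodgeRepro2.T6B5IsoHyp

/-!
# T6B5Identity — Tier 6, sub-goal B5: TIER4 Theorem B5.1(iv), the Hom-form identity, in kernel

TIER4 §B5 Step 5 [P] in kernel over B5's representation-level datum `𝓛` and its shape `shape 𝓛 h411 K₀`:
* `B5_identity` — `[M̃_μ : ℚ] · d(μ, L) = dim_ℚ Hom_E(A_L, A_μ)_ℚ` for every conjugate symplectic weight-one `μ`,
  every small compact open `L` and every finite set exhausting the classes ω(μ, ε, χ) with non-zero `L`-invariants
  (`d(μ, L) = Liu.liuMultiplicity`): Lemma B5.7 for Mathlib's `Representation.directSum` (accepted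
  `T6B5DirectSum.finrank_invariants_directSum`), Lemma B5.6 (accepted `finrank_mul_finrank_invariants`), the
  transport of invariants along the displayed isomorphism of Thm. 4.18 (accepted `finrank_invariants_congr`) and
  t6-p6's display of Thm. 4.18(1) at the shape — NO finiteness hypothesis beyond the displays: the finite support of
  the direct-sum count is the exhausting set (t6-p6's display of Cor. 4.20 provides one);
* `B5_identity_of_cor420` — the same with the exhausting set taken from t6-p6's Cor. 4.20 display;
* `finrank_Mt_le_finrank_HomQ` — the «in particular» clause: `d(μ, L) ≥ 1` gives
  `[M̃_μ : ℚ] ≤ dim_ℚ Hom_E(A_L, A_μ)_ℚ`, hence `Hom ≠ 0` once M̃_μ is a number field (the displayed p. 41 sentence);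
* `Thm4_18_iso_of_directSum` — t6-p6's numeric display `Hyp.Liu2021_Thm4_18_iso` (the binder of `B3_main`) DERIVED
  at the shape from the faithful display, Def. 4.11, the number-field display and Cor. 4.20 (for `n ⩾ 3`).
Every published input is consumed BY NAME. README §8(d): uses an L-value-free non-vanishing device: NO.
-/

namespace Summit.Ventures.HodgeRepro2.T6.B5Identity

open Summit.Ventures.HodgeRepro2.LevelPositivity Summit.Ventures.HodgeRepro2.ShimuraData
  Summit.Ventures.HodgeRepro2.T6.B5Datum Summit.Ventures.HodgeRepro2.T6.B5Main
  Summit.Ventures.HodgeRepro2.T6.B5DirectSum Summit.Ventures.HodgeRepro2.T6.B5Orbit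
  Summit.Ventures.HodgeRepro2.T6.Hyp
open Module TensorProduct

universe u

variable {K : Type u} [Field K] [NumberField K] [NumberField.IsCMField K] {c : Liu.IdeleConjugation K}
  {χEF : Liu.QuadraticCharacter K c} (𝓛 : LiuAlbaneseDatum K c χEF)

/-- The index of the direct sum of Thm. 4.18 at `μ`: the classes `𝓛.osc t` of the admissible triples `t` with first
component `μ` (the subtype of `Hyp.Liu2021_Thm4_18_directSum`, named). -/
abbrev Idx (μ : Liu.AutomorphicCharacter K) : Type :=
  {r : 𝓛.Rep // ∃ t : Liu.OscillatorTriple K c χEF, t.μ = μ ∧ Liu.OscillatorTriple.IsAdmissible K t ∧ 𝓛.osc t = r}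

/-- The summand invariants are finite-dimensional at a compact open level (the displayed Def. 4.11, admissibility). -/
theorem finiteDimensional_summand (h411 : Liu2021_Def4_11 𝓛) (μ : Liu.AutomorphicCharacter K)
    (L : OpenSubgroup 𝓛.G) (hL : IsCompact (L : Set 𝓛.G)) (r : Idx 𝓛 μ) :
    FiniteDimensional ℂ (invariants (𝓛.ω r.1) (L : Subgroup 𝓛.G)) := by
  obtain ⟨t, -, -, ht⟩ := r.2
  rw [← ht]
  exact hfd_of 𝓛 h411 t L hL

/-- The classes of an exhausting set, as a finite set of `𝓛.Rep`: the image of `T` under `(shape 𝓛 h411 K₀).osc`,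
read in `𝓛.Rep`, is the image of `T` under `𝓛.osc`. -/
theorem image_shape_osc_val [DecidableEq 𝓛.Rep] (h411 : Liu2021_Def4_11 𝓛) (K₀ : OpenSubgroup 𝓛.G)
    (T : Finset (Liu.OscillatorTriple K c χEF)) :
    (T.image (shape 𝓛 h411 K₀).osc).image (fun π : (shape 𝓛 h411 K₀).Rep => Subtype.val π) =
      T.image 𝓛.osc := by
  ext r
  simp only [Finset.mem_image]
  constructor
  · rintro ⟨π, ⟨t, htT, rfl⟩, rfl⟩
    exact ⟨t, htT, rfl⟩
  · rintro ⟨t, htT, rfl⟩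
    exact ⟨(shape 𝓛 h411 K₀).osc t, ⟨t, htT, rfl⟩, rfl⟩

/-- The finite-support sum over the classes of Thm. 4.18 equals `d(μ, L)` computed from any exhausting set. -/
theorem finsum_finrank_eq_liuMultiplicity (h411 : Liu2021_Def4_11 𝓛) (K₀ : OpenSubgroup 𝓛.G)
    (μ : Liu.AutomorphicCharacter K) (L : CLevel 𝓛) (T : Finset (Liu.OscillatorTriple K c χEF))
    (hT : IsExhausting (shape 𝓛 h411 K₀) μ T L) :
    ∑ᶠ r : Idx 𝓛 μ, finrank ℂ (invariants (𝓛.ω r.1) (L.1 : Subgroup 𝓛.G)) =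
      Liu.liuMultiplicity K (shape 𝓛 h411 K₀) T L := by
  classical
  set f : 𝓛.Rep → ℕ := fun r => finrank ℂ (invariants (𝓛.ω r) (L.1 : Subgroup 𝓛.G)) with hf
  have h1 : ∑ᶠ r : Idx 𝓛 μ, f r.1 =
      ∑ᶠ r ∈ {r : 𝓛.Rep | ∃ t : Liu.OscillatorTriple K c χEF,
        t.μ = μ ∧ Liu.OscillatorTriple.IsAdmissible K t ∧ 𝓛.osc t = r}, f r :=
    finsum_subtype_eq_finsum_cond (f := f) _
  have h2 : ∑ᶠ r ∈ {r : 𝓛.Rep | ∃ t : Liu.OscillatorTriple K c χEF,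
        t.μ = μ ∧ Liu.OscillatorTriple.IsAdmissible K t ∧ 𝓛.osc t = r}, f r = ∑ r ∈ T.image 𝓛.osc, f r := by
    apply finsum_mem_eq_sum_of_subset
    · rintro r ⟨⟨t, htμ, htadm, rfl⟩, hr⟩
      have hpos : 0 < (shape 𝓛 h411 K₀).dimInv ((shape 𝓛 h411 K₀).osc t) L := Nat.pos_of_ne_zero hr
      have hmem := hT.2 t htadm htμ hpos
      obtain ⟨t', ht'T, ht'⟩ := Finset.mem_image.mp hmem
      refine Finset.mem_coe.mpr (Finset.mem_image.mpr ⟨t', ht'T, ?_⟩)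
      exact congrArg Subtype.val ht'
    · intro r hr
      obtain ⟨t, htT, rfl⟩ := Finset.mem_image.mp (Finset.mem_coe.mp hr)
      exact ⟨t, (hT.1 t htT).1, (hT.1 t htT).2, rfl⟩
  have h3 : ∑ r ∈ T.image 𝓛.osc, f r = Liu.liuMultiplicity K (shape 𝓛 h411 K₀) T L := by
    unfold Liu.liuMultiplicity
    rw [← image_shape_osc_val 𝓛 h411 K₀ T]
    exact Finset.sum_image (fun x _ y _ h => Subtype.val_injective h)
  exact h1.trans (h2.trans h3)

/-- TIER4 Theorem B5.1(iv), Step 5 [P]: `[M̃_μ : ℚ] · d(μ, L) = dim_ℚ Hom_E(A_L, A_μ)_ℚ` for every conjugate symplectic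
weight-one `μ`, every small compact open `L ≤ K₀` and every finite set `T` exhausting the classes ω(μ, ε, χ) with
non-zero `L`-invariants (`d(μ, L) = Liu.liuMultiplicity K (shape 𝓛 h411 K₀) T L`). Inputs: the displayed Def. 4.11
(finite-dimensional invariants), the displayed isomorphism of Thm. 4.18 (`Hyp.Liu2021_Thm4_18_directSum`), t6-p6's
display of Thm. 4.18(1) at the shape (`dim_ℚ Ω(μ)^L = dim_ℚ Hom`). Kernel steps: the isomorphism transports invariants
(`finrank_invariants_congr`), the invariants of a direct sum are the direct sum of the invariants and their dimension
the finite-support sum (`finrank_invariants_directSum`, Lemma B5.7), `dim_ℚ = [M̃_μ : ℚ] · dim_ℂ` of the base change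
(`finrank_mul_finrank_invariants`, Lemma B5.6). -/
theorem B5_identity (h411 : Liu2021_Def4_11 𝓛) (K₀ : OpenSubgroup 𝓛.G)
    (hds : Liu2021_Thm4_18_directSum 𝓛) (h4181 : Liu2021_Thm4_18_1 (shape 𝓛 h411 K₀))
    (μ : Liu.AutomorphicCharacter K) (hμ : Liu.IsWeightOneConjugateSymplectic K c χEF μ)
    (L : CLevel 𝓛) (hL : (shape 𝓛 h411 K₀).IsSmall L)
    (T : Finset (Liu.OscillatorTriple K c χEF)) (hT : IsExhausting (shape 𝓛 h411 K₀) μ T L) :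
    finrank ℚ (𝓛.Mt μ) * Liu.liuMultiplicity K (shape 𝓛 h411 K₀) T L = finrank ℚ (𝓛.HomQ L.1 μ) := by
  obtain ⟨e, he⟩ := hds μ hμ
  have hA : finrank ℚ (invariants (𝓛.ρΩ μ) (L.1 : Subgroup 𝓛.G)) = finrank ℚ (𝓛.HomQ L.1 μ) :=
    h4181 μ hμ L hL
  have hB := finrank_mul_finrank_invariants (Q := ℚ) (C := ℂ) (𝓛.ρΩ μ) (L.1 : Subgroup 𝓛.G)
  have hC := finrank_invariants_congr (baseChangeRep (𝓛.ρΩ μ))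
    (Representation.directSum fun r : Idx 𝓛 μ => 𝓛.ω r.1) e he (L.1 : Subgroup 𝓛.G)
  haveI : ∀ r : Idx 𝓛 μ, FiniteDimensional ℂ (invariants (𝓛.ω r.1) (L.1 : Subgroup 𝓛.G)) :=
    finiteDimensional_summand 𝓛 h411 μ L.1 L.2
  have hsupp : (Function.support fun r : Idx 𝓛 μ =>
      finrank ℂ (invariants (𝓛.ω r.1) (L.1 : Subgroup 𝓛.G))).Finite := by
    classical
    refine (Finset.finite_toSet (T.image 𝓛.osc)).preimage (Subtype.val_injective.injOn) |>.subset ?_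
    rintro ⟨r, t, htμ, htadm, rfl⟩ hr
    have hpos : 0 < (shape 𝓛 h411 K₀).dimInv ((shape 𝓛 h411 K₀).osc t) L :=
      Nat.pos_of_ne_zero (Function.mem_support.mp hr)
    obtain ⟨t', ht'T, ht'⟩ := Finset.mem_image.mp (hT.2 t htadm htμ hpos)
    exact Finset.mem_coe.mpr (Finset.mem_image.mpr ⟨t', ht'T, congrArg Subtype.val ht'⟩)
  have hD := finrank_invariants_directSum (fun r : Idx 𝓛 μ => 𝓛.ω r.1) (L.1 : Subgroup 𝓛.G) hsupp
  have hE := finsum_finrank_eq_liuMultiplicity 𝓛 h411 K₀ μ L T hT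
  rw [← hA, ← hB, hC, hD, hE]

/-- `B5_identity` with the exhausting set supplied by t6-p6's display of Cor. 4.20 (`n ⩾ 3`): at every small level
`L` there is, for every conjugate symplectic weight-one `μ`, a finite set `T μ` with
`[M̃_μ : ℚ] · d(μ, L) = dim_ℚ Hom_E(A_L, A_μ)_ℚ`. -/
theorem B5_identity_of_cor420 (h411 : Liu2021_Def4_11 𝓛) (K₀ : OpenSubgroup 𝓛.G)
    (hds : Liu2021_Thm4_18_directSum 𝓛) (h4181 : Liu2021_Thm4_18_1 (shape 𝓛 h411 K₀))
    (h420 : Liu2021_Cor4_20 (shape 𝓛 h411 K₀)) (hn : 3 ≤ 𝓛.n)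
    (L : CLevel 𝓛) (hL : (shape 𝓛 h411 K₀).IsSmall L) :
    ∃ T : Liu.AutomorphicCharacter K → Finset (Liu.OscillatorTriple K c χEF),
      (∀ μ, IsExhausting (shape 𝓛 h411 K₀) μ (T μ) L) ∧
      ∀ μ, Liu.IsWeightOneConjugateSymplectic K c χEF μ →
        finrank ℚ (𝓛.Mt μ) * Liu.liuMultiplicity K (shape 𝓛 h411 K₀) (T μ) L = finrank ℚ (𝓛.HomQ L.1 μ) := by
  obtain ⟨-, T, -, h2, -, -, -⟩ := cor420_exhausting (shape 𝓛 h411 K₀) h420 hn L hL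
  exact ⟨T, h2, fun μ hμ => B5_identity 𝓛 h411 K₀ hds h4181 μ hμ L hL (T μ) (h2 μ)⟩

/-- The «in particular» clause of TIER4 Theorem B5.1(iv): if `d(μ, L) ≥ 1` then
`[M̃_μ : ℚ] ≤ dim_ℚ Hom_E(A_L, A_μ)_ℚ`; with the displayed «M̃_μ is a number field» (`[M̃_μ : ℚ] ≥ 1`),
`Hom_E(A_L, A_μ)_ℚ ≠ 0`. -/
theorem finrank_Mt_le_finrank_HomQ (h411 : Liu2021_Def4_11 𝓛) (K₀ : OpenSubgroup 𝓛.G)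
    (hds : Liu2021_Thm4_18_directSum 𝓛) (h4181 : Liu2021_Thm4_18_1 (shape 𝓛 h411 K₀))
    (μ : Liu.AutomorphicCharacter K) (hμ : Liu.IsWeightOneConjugateSymplectic K c χEF μ)
    (L : CLevel 𝓛) (hL : (shape 𝓛 h411 K₀).IsSmall L)
    (T : Finset (Liu.OscillatorTriple K c χEF)) (hT : IsExhausting (shape 𝓛 h411 K₀) μ T L)
    (hpos : 0 < Liu.liuMultiplicity K (shape 𝓛 h411 K₀) T L) :
    finrank ℚ (𝓛.Mt μ) ≤ finrank ℚ (𝓛.HomQ L.1 μ) := by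
  rw [← B5_identity 𝓛 h411 K₀ hds h4181 μ hμ L hL T hT]
  exact Nat.le_mul_of_pos_right _ hpos

/-- `Hom_E(A_L, A_μ)_ℚ ≠ 0` from the identity and the displayed number-field sentence (TIER4 Theorem B5.1(iv),
«in particular»). -/
theorem nontrivial_HomQ_of_pos (h411 : Liu2021_Def4_11 𝓛) (K₀ : OpenSubgroup 𝓛.G)
    (hds : Liu2021_Thm4_18_directSum 𝓛) (h4181 : Liu2021_Thm4_18_1 (shape 𝓛 h411 K₀))
    (hnf : Liu2021_p41_numberField 𝓛)
    (μ : Liu.AutomorphicCharacter K) (hμ : Liu.IsWeightOneConjugateSymplectic K c χEF μ)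
    (L : CLevel 𝓛) (hL : (shape 𝓛 h411 K₀).IsSmall L)
    (T : Finset (Liu.OscillatorTriple K c χEF)) (hT : IsExhausting (shape 𝓛 h411 K₀) μ T L)
    (hpos : 0 < Liu.liuMultiplicity K (shape 𝓛 h411 K₀) T L) : Nontrivial (𝓛.HomQ L.1 μ) := by
  haveI : FiniteDimensional ℚ (𝓛.Mt μ) := hnf μ hμ.1
  have h1 : 0 < finrank ℚ (𝓛.Mt μ) := Module.finrank_pos
  exact Module.nontrivial_of_finrank_pos (R := ℚ)
    (lt_of_lt_of_le h1 (finrank_Mt_le_finrank_HomQ 𝓛 h411 K₀ hds h4181 μ hμ L hL T hT hpos))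

/-- t6-p6's display of Thm. 4.18 over p2's datum (`Hyp.Liu2021_Thm4_18_iso`: `dim ω(μ, ε, χ)^L ≤ dim_ℚ Ω(μ)^L`, the
binder of `B3_main`) DERIVED at B5's shape from the faithful display of the isomorphism, the displayed Def. 4.11,
the displayed «M̃_μ is a number field» and t6-p6's display of Cor. 4.20 (which supplies the exhausting set), for
`n ⩾ 3`. -/
theorem Thm4_18_iso_of_directSum (h411 : Liu2021_Def4_11 𝓛) (K₀ : OpenSubgroup 𝓛.G)
    (hds : Liu2021_Thm4_18_directSum 𝓛) (hnf : Liu2021_p41_numberField 𝓛)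
    (h420 : Liu2021_Cor4_20 (shape 𝓛 h411 K₀)) (hn : 3 ≤ 𝓛.n) :
    Liu2021_Thm4_18_iso (shape 𝓛 h411 K₀) := by
  intro t ht L hL
  obtain ⟨-, T, -, h2, -, -, -⟩ := cor420_exhausting (shape 𝓛 h411 K₀) h420 hn L hL
  have hμ : Liu.IsWeightOneConjugateSymplectic K c χEF t.μ :=
    Liu.OscillatorTriple.isWeightOneConjugateSymplectic K ht
  obtain ⟨e, he⟩ := hds t.μ hμ
  -- dim ω^L ≤ d(μ, L) = Σ over the exhausting set
  have hle : (shape 𝓛 h411 K₀).dimInv ((shape 𝓛 h411 K₀).osc t) L ≤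
      Liu.liuMultiplicity K (shape 𝓛 h411 K₀) (T t.μ) L := by
    by_cases hpos : 0 < (shape 𝓛 h411 K₀).dimInv ((shape 𝓛 h411 K₀).osc t) L
    · obtain ⟨t', ht'T, ht'⟩ := Finset.mem_image.mp ((h2 t.μ).2 t ht rfl hpos)
      have := Liu.dimInv_le_liuMultiplicity K (shape 𝓛 h411 K₀) ht'T L
      rwa [ht'] at this
    · exact (Nat.eq_zero_of_not_pos hpos).symm ▸ Nat.zero_le _
  -- d(μ, L) ≤ [M̃_μ : ℚ] · d(μ, L) = dim_ℚ Ω(μ)^L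
  haveI : FiniteDimensional ℚ (𝓛.Mt t.μ) := hnf t.μ hμ.1
  have h1 : 0 < finrank ℚ (𝓛.Mt t.μ) := Module.finrank_pos
  have hB := finrank_mul_finrank_invariants (Q := ℚ) (C := ℂ) (𝓛.ρΩ t.μ) (L.1 : Subgroup 𝓛.G)
  have hC := finrank_invariants_congr (baseChangeRep (𝓛.ρΩ t.μ))
    (Representation.directSum fun r : Idx 𝓛 t.μ => 𝓛.ω r.1) e he (L.1 : Subgroup 𝓛.G)
  haveI : ∀ r : Idx 𝓛 t.μ, FiniteDimensional ℂ (invariants (𝓛.ω r.1) (L.1 : Subgroup 𝓛.G)) :=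
    finiteDimensional_summand 𝓛 h411 t.μ L.1 L.2
  have hsupp : (Function.support fun r : Idx 𝓛 t.μ =>
      finrank ℂ (invariants (𝓛.ω r.1) (L.1 : Subgroup 𝓛.G))).Finite := by
    classical
    refine (Finset.finite_toSet ((T t.μ).image 𝓛.osc)).preimage (Subtype.val_injective.injOn) |>.subset ?_
    rintro ⟨r, t'', htμ, htadm, rfl⟩ hr
    have hpos : 0 < (shape 𝓛 h411 K₀).dimInv ((shape 𝓛 h411 K₀).osc t'') L :=
      Nat.pos_of_ne_zero (Function.mem_support.mp hr)
    obtain ⟨t', ht'T, ht'⟩ := Finset.mem_image.mp ((h2 t.μ).2 t'' htadm htμ hpos)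
    exact Finset.mem_coe.mpr (Finset.mem_image.mpr ⟨t', ht'T, congrArg Subtype.val ht'⟩)
  have hD := finrank_invariants_directSum (fun r : Idx 𝓛 t.μ => 𝓛.ω r.1) (L.1 : Subgroup 𝓛.G) hsupp
  have hE := finsum_finrank_eq_liuMultiplicity 𝓛 h411 K₀ t.μ L (T t.μ) (h2 t.μ)
  show (shape 𝓛 h411 K₀).dimInv ((shape 𝓛 h411 K₀).osc t) L ≤
    finrank ℚ (invariants (𝓛.ρΩ t.μ) (L.1 : Subgroup 𝓛.G))
  rw [← hB, hC, hD, hE]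
  exact hle.trans (Nat.le_mul_of_pos_left _ h1)

end Summit.Ventures.HodgeRepro2.T6.B5Identity
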